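import Summits.BirchSwinnertonDyer.BirchSwinnertonDyer.Theorems.BiquadraticEisensteinDescentSymbolicMonskyClosureDefs
import Summits.BirchSwinnertonDyer.BirchSwinnertonDyer.Theorems.BiquadraticEisensteinDescentHeegnerTwistCouplingInSupplySymbolicMonskyPatternFree
import HarnessLib

set_option linter.dupNamespace false -- `Summit.BirchSwinnertonDyer.BirchSwinnertonDyer.Theorems.…` (summit = sub)
set_option autoImplicit false

/-!
# Crux `HeegnerTwistCouplingInSupply` (stmt-BirchSwinnertonDyer-21381) — the MULTI-STAGE (closure) pattern-free criterion, part 1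
# (abstract): two `𝔽₂`-matrices agreeing off an auxiliary block direction by direction, and soundness of the staged verified checks

Route `BiquadraticEisensteinDescent` (cell `pub/bsd-wall`, width seat `bsd-wall-cm-bed-w3` g21; `--supports` 21381, helper). Companion
proof file (1/2) of the reviewed definitions `…SymbolicMonskyClosureDefs` (p726614); builds on w3 g20's one-stage criterion
(`…SymbolicMonskyPatternFree`: `selector_identity`, `admissibleSel_spec`, `det_eq_one_of_agree_off_block`).

THE MECHANISM. In Monsky's matrix the mutual symbols of the auxiliary block `Q` enter a half-one row only through the coordinates
`z_(inl q)`, a half-two row only through the `z_(inr q)`, and the SUM of the two rows of an index only through the sums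
`z_(inl q) + z_(inr q)` (`q ∈ Q`). So a kernel vector that is `Q`-constant in ONE direction `δ ∈ {u = inl, v = inr, w = inl + inr}` makes
the direction-`δ` rows pattern-independent; they may then be used (stage two) to certify constancy in a second direction; two directions
give constancy in both halves and `det M(reference) = 1` finishes (`det_eq_one_of_closureCheckRows`). §2 unpacks the computable checks
(`admissibleSel2_spec`, `selCheck_spec`, `stageCheck1/2_spec`, `closureCheckRows_spec`); §3 shows that a certified target forces the
corresponding direction difference to vanish (`sum_bz_diffTarget`, `dval_eq_of_selCheck`); §4 shows that admissible selector functionals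
vanish at each stage (`selSum_eq_zero_stage1/2`); §5 is the abstract criterion. Part 2 (`…ClosureSymb`) supplies the direction-wise
agreement of the symbolic matrices and the ★ theorems, general-`k` recipes, doors and the `k = 3` exceptional examples.

HONEST FRAMING: linear algebra over `𝔽₂`; proves no instance by itself; the crux as stated (C⁺), its registered stubs and BSD are NOT
touched; nothing is closed. THEOREMS ONLY (no `def`). References: [HeathBrown1994] appendix (Monsky), typescript pp. 39–41;
[Feng1996] K. Feng, Acta Arith. 75 (1996) §2.
-/

namespace Summit.BirchSwinnertonDyer.BirchSwinnertonDyer.Theorems.SymbolicMonsky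

section ClosureAbstract

open Matrix

variable {k : ℕ}

/-! ### §1 Direction values and small `𝔽₂` facts -/

/-- `bz` of a XOR of bitmasks, bitwise. -/
theorem bz_testBit_xor (a b : ℕ) (l : ℕ) : bz ((a ^^^ b).testBit l) = bz (a.testBit l) + bz (b.testBit l) := by
  rw [Nat.testBit_xor, bz_xor_add]

/-- The functional of a XOR of two targets is the sum of the functionals. -/
theorem sum_bz_testBit_xor_mul (a b : ℕ) (n : ℕ) (g : Fin n → ZMod 2) :
    (∑ l : Fin n, bz ((a ^^^ b).testBit l.val) * g l) =
      (∑ l : Fin n, bz (a.testBit l.val) * g l) + ∑ l : Fin n, bz (b.testBit l.val) * g l := by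
  rw [← Finset.sum_add_distrib]
  exact Finset.sum_congr rfl fun l _ => by rw [bz_testBit_xor, add_mul]

/-- In `𝔽₂`, `a + b = 0 ↔ a = b` (restated direction; private: a public copy would duplicate a Literature lemma). -/
private theorem zmod_two_add_eq_zero_iff (a b : ZMod 2) : a + b = 0 ↔ a = b :=
  (zmod_two_eq_iff_add_eq_zero a b).symm

/-! ### §2 Unpacking the checks -/

/-- Unpacking `admissibleSel2`. -/
theorem admissibleSel2_spec {Q : Fin k → Bool} {δ₁ c : ℕ} (h : admissibleSel2 k Q δ₁ c = true) {i j : Fin k}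
    (hi : Q i = true) (hj : Q j = true) :
    (δ₁ = 0 → c.testBit (k + i.val) = c.testBit (k + j.val)) ∧
    (δ₁ = 1 → c.testBit i.val = c.testBit j.val) ∧
    (δ₁ ≠ 0 → δ₁ ≠ 1 → xor (c.testBit i.val) (c.testBit (k + i.val)) = xor (c.testBit j.val) (c.testBit (k + j.val))) := by
  simp only [admissibleSel2, List.all_eq_true, List.mem_finRange, true_implies, Bool.or_eq_true, Bool.not_eq_true',
    Bool.and_eq_false_iff] at h
  have h' := h i j
  rcases h' with h' | h'
  · rcases h' with h' | h'
    · rw [hi] at h'; exact absurd h' (by decide)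
    · rw [hj] at h'; exact absurd h' (by decide)
  · refine ⟨fun h0 => ?_, fun h1 => ?_, fun h0 h1 => ?_⟩
    · subst h0; simpa using h'
    · subst h1; simpa using h'
    · simp only [h0, h1, if_false] at h'; simpa using h'

/-- Unpacking `selCheck`: an admissible selector whose rows XOR to the target. -/
theorem selCheck_spec {adm : ℕ → Bool} {gens : List (ℕ × ℕ)} {R : List ℕ} {δt : ℕ} (h : selCheck adm gens R δt = true) :
    ∃ c : ℕ, adm c = true ∧ xorSelFrom c 0 R = δt := by
  simp only [selCheck, Bool.and_eq_true, beq_iff_eq] at h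
  exact ⟨_, h.1, h.2⟩

/-- Unpacking the `match` of `stageCheck1`. -/
theorem stageCheck1_spec {Q : Fin k → Bool} {R : List ℕ} {δ₁ : ℕ} (h : stageCheck1 k Q R δ₁ = true) {q : Fin k}
    (hq : Q q = true) :
    ∃ q₀ : Fin k, Q q₀ = true ∧ ∀ q' : Fin k, Q q' = true → q' ≠ q₀ →
      selCheck (admissibleSel k Q) (pfGens k Q R) R (diffTarget k δ₁ q₀.val q'.val) = true := by
  unfold stageCheck1 at h
  have hmem : ∀ q' : Fin k, Q q' = true → q' ∈ (List.finRange k).filter Q := fun q' hq' =>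
    List.mem_filter.mpr ⟨List.mem_finRange q', hq'⟩
  rcases hL : (List.finRange k).filter Q with _ | ⟨q₀, qs⟩
  · have := hmem q hq; rw [hL] at this; simp at this
  · rw [hL] at h
    simp only [List.all_eq_true] at h
    have hq₀ : Q q₀ = true := by
      have : q₀ ∈ (List.finRange k).filter Q := by rw [hL]; exact List.mem_cons_self
      exact (List.mem_filter.mp this).2
    refine ⟨q₀, hq₀, fun q' hq' hne => ?_⟩
    have : q' ∈ (List.finRange k).filter Q := hmem q' hq'
    rw [hL, List.mem_cons] at this
    rcases this with rfl | hqs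
    · exact absurd rfl hne
    · exact h q' hqs

/-- Unpacking the `match` of `stageCheck2`. -/
theorem stageCheck2_spec {Q : Fin k → Bool} {R : List ℕ} {δ₁ δ₂ : ℕ} (h : stageCheck2 k Q R δ₁ δ₂ = true) {q : Fin k}
    (hq : Q q = true) :
    ∃ q₀ : Fin k, Q q₀ = true ∧ ∀ q' : Fin k, Q q' = true → q' ≠ q₀ →
      selCheck (admissibleSel2 k Q δ₁) (pfGens2 k Q δ₁ R) R (diffTarget k δ₂ q₀.val q'.val) = true := by
  unfold stageCheck2 at h
  have hmem : ∀ q' : Fin k, Q q' = true → q' ∈ (List.finRange k).filter Q := fun q' hq' =>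
    List.mem_filter.mpr ⟨List.mem_finRange q', hq'⟩
  rcases hL : (List.finRange k).filter Q with _ | ⟨q₀, qs⟩
  · have := hmem q hq; rw [hL] at this; simp at this
  · rw [hL] at h
    simp only [List.all_eq_true] at h
    have hq₀ : Q q₀ = true := by
      have : q₀ ∈ (List.finRange k).filter Q := by rw [hL]; exact List.mem_cons_self
      exact (List.mem_filter.mp this).2
    refine ⟨q₀, hq₀, fun q' hq' hne => ?_⟩
    have : q' ∈ (List.finRange k).filter Q := hmem q' hq'
    rw [hL, List.mem_cons] at this
    rcases this with rfl | hqs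
    · exact absurd rfl hne
    · exact h q' hqs

/-- Unpacking `closureCheckRows`: some ordered pair of distinct directions in `{0,1,2}` passes both stages. -/
theorem closureCheckRows_spec {Q : Fin k → Bool} {R : List ℕ} (h : closureCheckRows k Q R = true) :
    ∃ δ₁ δ₂ : ℕ, δ₁ ≤ 2 ∧ δ₂ ≤ 2 ∧ δ₁ ≠ δ₂ ∧ stageCheck1 k Q R δ₁ = true ∧ stageCheck2 k Q R δ₁ δ₂ = true := by
  simp only [closureCheckRows, dirPairs, List.any_cons, List.any_nil, Bool.or_false, Bool.or_eq_true,
    Bool.and_eq_true] at h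
  rcases h with h | h | h | h | h | h
  · exact ⟨0, 1, by omega, by omega, by omega, h.1, h.2⟩
  · exact ⟨0, 2, by omega, by omega, by omega, h.1, h.2⟩
  · exact ⟨1, 0, by omega, by omega, by omega, h.1, h.2⟩
  · exact ⟨1, 2, by omega, by omega, by omega, h.1, h.2⟩
  · exact ⟨2, 0, by omega, by omega, by omega, h.1, h.2⟩
  · exact ⟨2, 1, by omega, by omega, by omega, h.1, h.2⟩

/-! ### §3 A certified target forces a direction difference to vanish -/

/-- The functional of `diffTarget k δ a b` on `z` (coordinates through `finSumFinEquiv`) is the `δ`-difference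
`dval δ z a + dval δ z b`. -/
theorem sum_bz_diffTarget (δ : ℕ) (a b : Fin k) (z : Fin k ⊕ Fin k → ZMod 2) :
    (∑ l : Fin (k + k), bz ((diffTarget k δ a.val b.val).testBit l.val) * z (finSumFinEquiv.symm l)) =
      (if δ = 0 then z (Sum.inl a) else if δ = 1 then z (Sum.inr a) else z (Sum.inl a) + z (Sum.inr a)) +
      (if δ = 0 then z (Sum.inl b) else if δ = 1 then z (Sum.inr b) else z (Sum.inl b) + z (Sum.inr b)) := by
  -- the padded function of `ℕ`
  set g : ℕ → ZMod 2 := fun n => if hn : n < k + k then z (finSumFinEquiv.symm ⟨n, hn⟩) else 0 with hg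
  have hre : ∀ (T : ℕ), (∑ l : Fin (k + k), bz (T.testBit l.val) * z (finSumFinEquiv.symm l)) =
      ∑ l : Fin (k + k), bz (T.testBit l.val) * g l.val := fun T =>
    Finset.sum_congr rfl fun l _ => by simp [hg, l.isLt]
  have ga : g a.val = z (Sum.inl a) := by
    have : a.val < k + k := by omega
    simp only [hg, this, dite_true]
    exact congrArg z (finSumFinEquiv_symm_apply_castAdd (n := k) a)
  have gb : g b.val = z (Sum.inl b) := by
    have : b.val < k + k := by omega
    simp only [hg, this, dite_true]
    exact congrArg z (finSumFinEquiv_symm_apply_castAdd (n := k) b)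
  have gka : g (k + a.val) = z (Sum.inr a) := by
    have : k + a.val < k + k := by omega
    simp only [hg, this, dite_true]
    exact congrArg z (finSumFinEquiv_symm_apply_natAdd (m := k) a)
  have gkb : g (k + b.val) = z (Sum.inr b) := by
    have : k + b.val < k + k := by omega
    simp only [hg, this, dite_true]
    exact congrArg z (finSumFinEquiv_symm_apply_natAdd (m := k) b)
  have hu := sum_bz_testBit_two_pow_xor a.val b.val g (k + k) (by omega) (by omega)
  have hv := sum_bz_testBit_two_pow_xor (k + a.val) (k + b.val) g (k + k) (by omega) (by omega)
  rw [hre]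
  by_cases h0 : δ = 0
  · subst h0
    simp only [diffTarget, if_true]
    rw [hu, ga, gb]
  by_cases h1 : δ = 1
  · subst h1
    simp only [diffTarget, one_ne_zero, if_false, if_true]
    rw [hv, gka, gkb]
  simp only [diffTarget, h0, h1, if_false]
  rw [sum_bz_testBit_xor_mul, hu, hv, ga, gb, gka, gkb]
  ring

/-- **A certified target is sound**: if the selector functional `∑_l ĉ_l (M z)_l` vanishes for every `adm`-admissible selector `c`,
a passing `selCheck adm gens R (diffTarget k δ a b)` forces `dval δ z a = dval δ z b`. -/
theorem dval_eq_of_selCheck (M : Matrix (Fin k ⊕ Fin k) (Fin k ⊕ Fin k) (ZMod 2)) (R : List ℕ) (hR : R.length = k + k)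
    (hM : matOfRows (k + k) R = Matrix.reindex finSumFinEquiv finSumFinEquiv M) {adm : ℕ → Bool} {gens : List (ℕ × ℕ)}
    {δ : ℕ} {a b : Fin k} (h : selCheck adm gens R (diffTarget k δ a.val b.val) = true) (z : Fin k ⊕ Fin k → ZMod 2)
    (hvan : ∀ c : ℕ, adm c = true → (∑ l : Fin (k + k), bz (c.testBit l.val) * (M *ᵥ z) (finSumFinEquiv.symm l)) = 0) :
    (if δ = 0 then z (Sum.inl a) else if δ = 1 then z (Sum.inr a) else z (Sum.inl a) + z (Sum.inr a)) =
      (if δ = 0 then z (Sum.inl b) else if δ = 1 then z (Sum.inr b) else z (Sum.inl b) + z (Sum.inr b)) := by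
  obtain ⟨c, hadm, hsel⟩ := selCheck_spec h
  have hid := selector_identity M R hR hM c _ hsel z
  rw [hvan c hadm, sum_bz_diffTarget] at hid
  exact (zmod_two_add_eq_zero_iff _ _).mp hid.symm

/-! ### §4 Admissible selector functionals vanish -/

/-- A half-sum `∑_i bz(f i) g i` with `g` vanishing outside `Q` and `f` constant on `Q` is `0` when the `Q`-sum of `g` is `0`. -/
theorem half_sum_eq_zero_of_const (Q : Fin k → Bool) (f : Fin k → Bool) (g : Fin k → ZMod 2)
    (hf : ∀ i j, Q i = true → Q j = true → f i = f j) (hg : ∀ i, Q i = false → g i = 0)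
    (hs : (∑ i ∈ Finset.univ.filter (fun i => Q i = true), g i) = 0) :
    (∑ i : Fin k, bz (f i) * g i) = 0 := by
  classical
  by_cases hQ : ∃ i₀, Q i₀ = true
  · obtain ⟨i₀, hi₀⟩ := hQ
    have : ∀ i, bz (f i) * g i = bz (f i₀) * (if Q i = true then g i else 0) := by
      intro i
      by_cases hqi : Q i = true
      · rw [hf i i₀ hqi hi₀]; simp [hqi]
      · simp [hqi, hg i (by simpa using hqi)]
    rw [Finset.sum_congr rfl fun i _ => this i, ← Finset.mul_sum, ← Finset.sum_filter, hs, mul_zero]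
  · push Not at hQ
    exact Finset.sum_eq_zero fun i _ => by rw [hg i (by simpa using hQ i), mul_zero]

/-- A half-sum with `g` vanishing outside `Q` AND on `Q` is `0`. -/
theorem half_sum_eq_zero_of_rows (Q : Fin k → Bool) (f : Fin k → Bool) (g : Fin k → ZMod 2)
    (hg : ∀ i, Q i = false → g i = 0) (hq : ∀ i, Q i = true → g i = 0) :
    (∑ i : Fin k, bz (f i) * g i) = 0 := by
  refine Finset.sum_eq_zero fun i _ => ?_
  by_cases hqi : Q i = true
  · rw [hq i hqi, mul_zero]
  · rw [hg i (by simpa using hqi), mul_zero]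

/-- **Stage one**: a stage-one-admissible selector functional vanishes on `M z` when the rows outside `Q` kill `z` and both `Q`-row
sums of `M z` vanish. -/
theorem selSum_eq_zero_stage1 (Q : Fin k → Bool) (M : Matrix (Fin k ⊕ Fin k) (Fin k ⊕ Fin k) (ZMod 2)) {c : ℕ}
    (hadm : admissibleSel k Q c = true) (z : Fin k ⊕ Fin k → ZMod 2)
    (hz : ∀ i, Q i = false → (M *ᵥ z) (Sum.inl i) = 0 ∧ (M *ᵥ z) (Sum.inr i) = 0)
    (hs1 : (∑ i ∈ Finset.univ.filter (fun i => Q i = true), (M *ᵥ z) (Sum.inl i)) = 0)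
    (hs2 : (∑ i ∈ Finset.univ.filter (fun i => Q i = true), (M *ᵥ z) (Sum.inr i)) = 0) :
    (∑ l : Fin (k + k), bz (c.testBit l.val) * (M *ᵥ z) (finSumFinEquiv.symm l)) = 0 := by
  rw [sum_fin_add_bz (fun n => c.testBit n) (M *ᵥ z),
    half_sum_eq_zero_of_const Q (fun i => c.testBit i.val) (fun i => (M *ᵥ z) (Sum.inl i))
      (fun i j hi hj => (admissibleSel_spec hadm hi hj).1) (fun i hi => (hz i hi).1) hs1,
    half_sum_eq_zero_of_const Q (fun i => c.testBit (k + i.val)) (fun i => (M *ᵥ z) (Sum.inr i))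
      (fun i j hi hj => (admissibleSel_spec hadm hi hj).2) (fun i hi => (hz i hi).2) hs2, add_zero]

/-- **Stage two**: a selector functional admissible given `δ₁` vanishes on `M z` when, in addition, the direction-`δ₁` rows of `M z`
vanish on `Q` (`δ₁ = 0`: the half-one `Q`-rows; `δ₁ = 1`: the half-two `Q`-rows; otherwise: the row sums). -/
theorem selSum_eq_zero_stage2 (Q : Fin k → Bool) (M : Matrix (Fin k ⊕ Fin k) (Fin k ⊕ Fin k) (ZMod 2)) {δ₁ c : ℕ}
    (hadm : admissibleSel2 k Q δ₁ c = true) (z : Fin k ⊕ Fin k → ZMod 2)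
    (hz : ∀ i, Q i = false → (M *ᵥ z) (Sum.inl i) = 0 ∧ (M *ᵥ z) (Sum.inr i) = 0)
    (hs1 : (∑ i ∈ Finset.univ.filter (fun i => Q i = true), (M *ᵥ z) (Sum.inl i)) = 0)
    (hs2 : (∑ i ∈ Finset.univ.filter (fun i => Q i = true), (M *ᵥ z) (Sum.inr i)) = 0)
    (hrow : ∀ i, Q i = true →
      (if δ₁ = 0 then (M *ᵥ z) (Sum.inl i) else if δ₁ = 1 then (M *ᵥ z) (Sum.inr i)
       else (M *ᵥ z) (Sum.inl i) + (M *ᵥ z) (Sum.inr i)) = 0) :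
    (∑ l : Fin (k + k), bz (c.testBit l.val) * (M *ᵥ z) (finSumFinEquiv.symm l)) = 0 := by
  classical
  rw [sum_fin_add_bz (fun n => c.testBit n) (M *ᵥ z)]
  by_cases h0 : δ₁ = 0
  · subst h0
    have hrow' : ∀ i, Q i = true → (M *ᵥ z) (Sum.inl i) = 0 := fun i hi => by simpa using hrow i hi
    rw [half_sum_eq_zero_of_rows Q (fun i => c.testBit i.val) (fun i => (M *ᵥ z) (Sum.inl i)) (fun i hi => (hz i hi).1) hrow',
      half_sum_eq_zero_of_const Q (fun i => c.testBit (k + i.val)) (fun i => (M *ᵥ z) (Sum.inr i))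
        (fun i j hi hj => (admissibleSel2_spec hadm hi hj).1 rfl) (fun i hi => (hz i hi).2) hs2, add_zero]
  by_cases h1 : δ₁ = 1
  · subst h1
    have hrow' : ∀ i, Q i = true → (M *ᵥ z) (Sum.inr i) = 0 := fun i hi => by simpa using hrow i hi
    rw [half_sum_eq_zero_of_const Q (fun i => c.testBit i.val) (fun i => (M *ᵥ z) (Sum.inl i))
        (fun i j hi hj => (admissibleSel2_spec hadm hi hj).2.1 rfl) (fun i hi => (hz i hi).1) hs1,
      half_sum_eq_zero_of_rows Q (fun i => c.testBit (k + i.val)) (fun i => (M *ᵥ z) (Sum.inr i)) (fun i hi => (hz i hi).2) hrow',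
      add_zero]
  -- δ₁ = w: the half-one and half-two `Q`-rows of `M z` agree, and `c_i + c_(k+i)` is constant on `Q`
  have hrow' : ∀ i, Q i = true → (M *ᵥ z) (Sum.inl i) = (M *ᵥ z) (Sum.inr i) := fun i hi => by
    have := hrow i hi
    simp only [h0, h1, if_false] at this
    exact (zmod_two_add_eq_zero_iff _ _).mp this
  rw [← Finset.sum_add_distrib]
  -- termwise: outside `Q` both vanish; inside `Q` combine
  have step : ∀ i : Fin k, bz (c.testBit i.val) * (M *ᵥ z) (Sum.inl i) + bz (c.testBit (k + i.val)) * (M *ᵥ z) (Sum.inr i) =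
      bz (xor (c.testBit i.val) (c.testBit (k + i.val))) * (if Q i = true then (M *ᵥ z) (Sum.inr i) else 0) := by
    intro i
    by_cases hqi : Q i = true
    · rw [hrow' i hqi, if_pos hqi, bz_xor_add, add_mul]
    · have hqi' : Q i = false := by simpa using hqi
      rw [(hz i hqi').1, (hz i hqi').2, if_neg hqi, mul_zero, mul_zero, mul_zero, add_zero]
  rw [Finset.sum_congr rfl fun i _ => step i]
  exact half_sum_eq_zero_of_const Q (fun i => xor (c.testBit i.val) (c.testBit (k + i.val)))
    (fun i => if Q i = true then (M *ᵥ z) (Sum.inr i) else 0)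
    (fun i j hi hj => (admissibleSel2_spec hadm hi hj).2.2 h0 h1) (fun i hi => by simp [hi])
    (by rw [Finset.sum_congr rfl fun i hi => if_pos (Finset.mem_filter.mp hi).2]; exact hs2)

/-! ### §5 The abstract closure criterion -/

/-- Two certified directions out of `{u, v, w}` make `z` constant on `Q` in both halves. -/
theorem qconst_of_two_directions {Q : Fin k → Bool} (z : Fin k ⊕ Fin k → ZMod 2) {δ₁ δ₂ : ℕ} (h1 : δ₁ ≤ 2) (h2 : δ₂ ≤ 2)
    (hne : δ₁ ≠ δ₂)
    (c1 : ∀ i j, Q i = true → Q j = true →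
      (if δ₁ = 0 then z (Sum.inl i) else if δ₁ = 1 then z (Sum.inr i) else z (Sum.inl i) + z (Sum.inr i)) =
      (if δ₁ = 0 then z (Sum.inl j) else if δ₁ = 1 then z (Sum.inr j) else z (Sum.inl j) + z (Sum.inr j)))
    (c2 : ∀ i j, Q i = true → Q j = true →
      (if δ₂ = 0 then z (Sum.inl i) else if δ₂ = 1 then z (Sum.inr i) else z (Sum.inl i) + z (Sum.inr i)) =
      (if δ₂ = 0 then z (Sum.inl j) else if δ₂ = 1 then z (Sum.inr j) else z (Sum.inl j) + z (Sum.inr j)))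
    (i j : Fin k) (hi : Q i = true) (hj : Q j = true) :
    z (Sum.inl i) = z (Sum.inl j) ∧ z (Sum.inr i) = z (Sum.inr j) := by
  have a := c1 i j hi hj
  have b := c2 i j hi hj
  -- enumerate the six ordered pairs
  have key : ∀ d1 d2 : ℕ, d1 ≤ 2 → d2 ≤ 2 → d1 ≠ d2 → ∀ (x y x' y' : ZMod 2),
      (if d1 = 0 then x else if d1 = 1 then y else x + y) = (if d1 = 0 then x' else if d1 = 1 then y' else x' + y') →
      (if d2 = 0 then x else if d2 = 1 then y else x + y) = (if d2 = 0 then x' else if d2 = 1 then y' else x' + y') →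
      x = x' ∧ y = y' := by
    intro d1 d2 hd1 hd2 hd
    interval_cases d1 <;> interval_cases d2 <;> first | exact absurd rfl hd | decide
  exact key δ₁ δ₂ h1 h2 hne _ _ _ _ a b

/-- **Abstract CLOSURE criterion.** Let `M, M'` be `𝔽₂`-matrices on `Fin k ⊕ Fin k` and `Q` an auxiliary block such that (i) the rows
outside `Q` agree, (ii) direction-wise: if `z` is `Q`-constant in direction `δ ∈ {u, v, w}` then the direction-`δ` rows (`u`: half one,
`v`: half two, `w`: row sums) of `M' z` and `M z` agree on `Q`, (ii') on vectors constant on `Q` in both halves `M' z = M z`, (iii) the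
`Q`-row sums agree in each half. If `det M = 1` and the closure check passes on bitmask rows `R` of `M`, then `det M' = 1`. [folklore] -/
theorem det_eq_one_of_closureCheckRows (Q : Fin k → Bool) (M M' : Matrix (Fin k ⊕ Fin k) (Fin k ⊕ Fin k) (ZMod 2))
    (R : List ℕ) (hR : R.length = k + k) (hM : matOfRows (k + k) R = Matrix.reindex finSumFinEquiv finSumFinEquiv M)
    (hout : ∀ z i, Q i = false →
      (M' *ᵥ z) (Sum.inl i) = (M *ᵥ z) (Sum.inl i) ∧ (M' *ᵥ z) (Sum.inr i) = (M *ᵥ z) (Sum.inr i))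
    (hdir : ∀ (z : Fin k ⊕ Fin k → ZMod 2) (δ : ℕ),
      (∀ i j, Q i = true → Q j = true →
        (if δ = 0 then z (Sum.inl i) else if δ = 1 then z (Sum.inr i) else z (Sum.inl i) + z (Sum.inr i)) =
        (if δ = 0 then z (Sum.inl j) else if δ = 1 then z (Sum.inr j) else z (Sum.inl j) + z (Sum.inr j))) →
      ∀ i, Q i = true →
        (if δ = 0 then (M' *ᵥ z) (Sum.inl i) else if δ = 1 then (M' *ᵥ z) (Sum.inr i)
          else (M' *ᵥ z) (Sum.inl i) + (M' *ᵥ z) (Sum.inr i)) =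
        (if δ = 0 then (M *ᵥ z) (Sum.inl i) else if δ = 1 then (M *ᵥ z) (Sum.inr i)
          else (M *ᵥ z) (Sum.inl i) + (M *ᵥ z) (Sum.inr i)))
    (hconst : ∀ z, (∀ i j, Q i = true → Q j = true → z (Sum.inl i) = z (Sum.inl j) ∧ z (Sum.inr i) = z (Sum.inr j)) →
      M' *ᵥ z = M *ᵥ z)
    (hsum : ∀ z, (∑ i ∈ Finset.univ.filter (fun i => Q i = true), (M' *ᵥ z) (Sum.inl i)) =
        (∑ i ∈ Finset.univ.filter (fun i => Q i = true), (M *ᵥ z) (Sum.inl i)) ∧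
      (∑ i ∈ Finset.univ.filter (fun i => Q i = true), (M' *ᵥ z) (Sum.inr i)) =
        (∑ i ∈ Finset.univ.filter (fun i => Q i = true), (M *ᵥ z) (Sum.inr i)))
    (hdet : M.det = 1) (hcl : closureCheckRows k Q R = true) :
    M'.det = 1 := by
  classical
  obtain ⟨δ₁, δ₂, hδ₁, hδ₂, hne, hst1, hst2⟩ := closureCheckRows_spec hcl
  have key : ∀ z, M' *ᵥ z = 0 → z = 0 := by
    intro z hz
    have h1 : ∀ i, Q i = false → (M *ᵥ z) (Sum.inl i) = 0 ∧ (M *ᵥ z) (Sum.inr i) = 0 := by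
      intro i hi
      obtain ⟨ha, hb⟩ := hout z i hi
      exact ⟨by rw [← ha, hz]; rfl, by rw [← hb, hz]; rfl⟩
    obtain ⟨hS1, hS2⟩ := hsum z
    have h2 : (∑ i ∈ Finset.univ.filter (fun i => Q i = true), (M *ᵥ z) (Sum.inl i)) = 0 := by
      rw [← hS1]; exact Finset.sum_eq_zero fun i _ => by rw [hz]; rfl
    have h3 : (∑ i ∈ Finset.univ.filter (fun i => Q i = true), (M *ᵥ z) (Sum.inr i)) = 0 := by
      rw [← hS2]; exact Finset.sum_eq_zero fun i _ => by rw [hz]; rfl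
    -- stage one: `z` is `Q`-constant in direction δ₁
    have c1 : ∀ i j, Q i = true → Q j = true →
        (if δ₁ = 0 then z (Sum.inl i) else if δ₁ = 1 then z (Sum.inr i) else z (Sum.inl i) + z (Sum.inr i)) =
        (if δ₁ = 0 then z (Sum.inl j) else if δ₁ = 1 then z (Sum.inr j) else z (Sum.inl j) + z (Sum.inr j)) := by
      intro i j hi hj
      obtain ⟨q₀, hq₀, hall⟩ := stageCheck1_spec hst1 hi
      have one : ∀ q : Fin k, Q q = true →
          (if δ₁ = 0 then z (Sum.inl q₀) else if δ₁ = 1 then z (Sum.inr q₀) else z (Sum.inl q₀) + z (Sum.inr q₀)) =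
          (if δ₁ = 0 then z (Sum.inl q) else if δ₁ = 1 then z (Sum.inr q) else z (Sum.inl q) + z (Sum.inr q)) := by
        intro q hq
        by_cases hq0 : q = q₀
        · subst hq0; rfl
        exact dval_eq_of_selCheck M R hR hM (hall q hq hq0) z
          (fun c hc => selSum_eq_zero_stage1 Q M hc z h1 h2 h3)
      exact (one i hi).symm.trans (one j hj)
    -- hence the direction-δ₁ rows of `M z` vanish on `Q`
    have hrow : ∀ i, Q i = true →
        (if δ₁ = 0 then (M *ᵥ z) (Sum.inl i) else if δ₁ = 1 then (M *ᵥ z) (Sum.inr i)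
          else (M *ᵥ z) (Sum.inl i) + (M *ᵥ z) (Sum.inr i)) = 0 := by
      intro i hi
      rw [← hdir z δ₁ c1 i hi, hz]
      simp
    -- stage two: `z` is `Q`-constant in direction δ₂
    have c2 : ∀ i j, Q i = true → Q j = true →
        (if δ₂ = 0 then z (Sum.inl i) else if δ₂ = 1 then z (Sum.inr i) else z (Sum.inl i) + z (Sum.inr i)) =
        (if δ₂ = 0 then z (Sum.inl j) else if δ₂ = 1 then z (Sum.inr j) else z (Sum.inl j) + z (Sum.inr j)) := by
      intro i j hi hj
      obtain ⟨q₀, hq₀, hall⟩ := stageCheck2_spec hst2 hi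
      have one : ∀ q : Fin k, Q q = true →
          (if δ₂ = 0 then z (Sum.inl q₀) else if δ₂ = 1 then z (Sum.inr q₀) else z (Sum.inl q₀) + z (Sum.inr q₀)) =
          (if δ₂ = 0 then z (Sum.inl q) else if δ₂ = 1 then z (Sum.inr q) else z (Sum.inl q) + z (Sum.inr q)) := by
        intro q hq
        by_cases hq0 : q = q₀
        · subst hq0; rfl
        exact dval_eq_of_selCheck M R hR hM (hall q hq hq0) z
          (fun c hc => selSum_eq_zero_stage2 Q M hc z h1 h2 h3 hrow)
      exact (one i hi).symm.trans (one j hj)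
    have hc := qconst_of_two_directions z hδ₁ hδ₂ hne c1 c2
    have hMz : M *ᵥ z = 0 := by rw [← hconst z hc, hz]
    by_contra hne'
    have : M.det = 0 := Matrix.exists_mulVec_eq_zero_iff.mp ⟨z, hne', hMz⟩
    rw [hdet] at this
    exact one_ne_zero this
  rcases zmod_two_eq_zero_or_eq_one M'.det with h0 | h1
  · obtain ⟨v, hv, hMv⟩ := Matrix.exists_mulVec_eq_zero_iff.mpr h0
    exact absurd (key v hMv) hv
  · exact h1

end ClosureAbstract

end Summit.BirchSwinnertonDyer.BirchSwinnertonDyer.Theorems.SymbolicMonsky
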